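import Summits.ResolutionOfSingularities.ResolutionOfSingularities.Theorems.PurelyInseparableDim4JointShapeSurvival
import HarnessLib

/-!
# Purely inseparable four-folds: SURVIVAL of a member TOGETHER WITH the VISIBILITY of its waiting regions (brick S3 (c) «joint
# point∘coordinate chains», part 47 = v3 threading input; cell `res-dim4-pi`)

[OURS · counted 0] (D-0157 DOOR 2; desk WORD #66 (4)(c), #74 (g), #99 (d); frame `PIDim4.TerminationImpliesOrderReduction`, S3 (c) v3;
host item stmt-ResolutionOfSingularities-16155, helper). Nothing here proves resolution of singularities in dimension ≥ 4 / characteristic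
`p` — NOT here, not anywhere in this programme.

Part 11's `member_survival_zigzag_shape`, VERBATIM, with one more conclusion about the SAME survivor chart `W ←φ′— Y′ —ψ′→ 𝔸⁵`
(`φ′ = (φ|_O) ≫ (π|_O)⁻¹ ≫ ι`, `ψ′ = ι ≫ ψ`, `O = X′ ∖ V(C)`): for EVERY set `D ⊆ 𝔸⁵` that the old chart SEES (`D ⊆ ψ(Y)`) with
`φ(ψ⁻¹ D)` closed, missed by every old boundary component and by the blown-up centre `V(C)`, the survivor chart again SEES `D`,
`φ′(ψ′⁻¹ D) = π⁻¹ φ(ψ⁻¹ D)` is closed, and every NEW boundary component (strict transforms and the exceptional one) misses it. These are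
exactly part 44's hypotheses `hWsee`/`hWc`/`hbdW` for a waiting region `D = W_T`: a waiting member hosted by a member that SURVIVES
a blow-up keeps its visibility data — the input the node theorem with waiting members at arbitrary depth needs (successor).

* **`member_survival_zigzag_shape_sees`**.

AI-produced formalisation, weaker than expert review. bears_on: LADDER-RESOLUTION:D157-DOOR2 (res-dim4-pi · S3 (c) joint v3 · threading).
-/

set_option linter.dupNamespace false -- D-0017: single-problem summit path `Summit.<S>.<S>.…` by design

noncomputable section

open MvPolynomial Finset CategoryTheory AlgebraicGeometry Opposite TopologicalSpace
open AlgebraicGeometry.Scheme.IdealSheafData (ofIdealTop vanishingIdeal)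

namespace Summit.ResolutionOfSingularities.ResolutionOfSingularities.Theorems.PIDim4

open Literature.AlgebraicGeometry.Resolution
open Literature.AlgebraicGeometry.Resolution.AffinePointBlowup (P A γ coord Wtop ξ)

namespace Equimultiple

section ShapeSees

variable {K : Type} [Field K]
variable {X' W Y : Scheme.{0}} {π : W ⟶ X'} {Ce : X'.IdealSheafData} {S : Finset (Fin 4)}

/-- **SURVIVAL WITH SHAPE AND VISIBILITY.** `π : W → X′` a blowing up along `C`, `c ⊆ X′` closed and disjoint from `V(C)`, a zigzag
chart `X′ ←φ— Y —ψ→ 𝔸⁵` with `I.comap φ = J.comap ψ`, `(vanishingIdeal c).comap φ = (𝓘Λ S).comap ψ`, `c ⊆ range φ`,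
`V(z, x_S) ⊆ range ψ`, and the translated shape `(idx, cst)` of a boundary `E` relative to `(φ, ψ, S)`. Then at `W`:
a zigzag chart `W ←φ′— Y′ —ψ′→ 𝔸⁵` reading `πᶜ(I, μ)` as `J`, reading `vanishingIdeal (π⁻¹c)` as `𝓘Λ S`, covering
`π⁻¹c`, seeing `V(z, x_S)`, AND the translated shape of `E.map (strictTransformIdeal π Ce) ++ [Ce.comap π]` relative to
`(φ′, ψ′, S)`. [cite: BierstoneGrigorievMilmanWlodarczyk2011, Def. 3.1.3 (2), (4)] [cite: StacksProject, Tag 02OS] -/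
theorem member_survival_zigzag_shape_sees [IsLocallyNoetherian X'] [IsLocallyNoetherian W] (hπ : IsBlowup π Ce)
    (c : Closeds X') (hdisj : Disjoint (c : Set X') (Ce.support : Set X')) (φ : Y ⟶ X') [IsOpenImmersion φ]
    (ψ : Y ⟶ P 4 K) [IsOpenImmersion ψ] (I : X'.IdealSheafData) (J : (P 4 K).IdealSheafData)
    (hI : I.comap φ = J.comap ψ) (μ : ℕ)
    (hZ : (vanishingIdeal c).comap φ = (AffineCoordBlowup.𝓘Λ 4 K (insert 0 (Fin.succ '' (S : Set (Fin 4))))).comap ψ)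
    (hcφ : (c : Set X') ⊆ Set.range φ)
    (hsee : (AffineCoordBlowup.CΛ 4 K (insert 0 (Fin.succ '' (S : Set (Fin 4)))) : Set (P 4 K)) ⊆ Set.range ψ)
    (E : List X'.IdealSheafData) (idx : X'.IdealSheafData → Fin 4) (cst : X'.IdealSheafData → K)
    (hshape : ∀ D ∈ E,
      ((D.support : Set X') ∩ φ '' (ψ ⁻¹'
        (AffineCoordBlowup.CΛ 4 K (insert 0 (Fin.succ '' (S : Set (Fin 4)))) : Set (P 4 K)))).Nonempty →
      D.comap φ = (ofIdealTop (Ideal.span {(γ 4 K).symm (X (idx D).succ + C (cst D))})).comap ψ ∧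
        (idx D ∈ S → cst D = 0))
    (hinj : ∀ D₁ ∈ E, ∀ D₂ ∈ E,
      ((D₁.support : Set X') ∩ φ '' (ψ ⁻¹'
        (AffineCoordBlowup.CΛ 4 K (insert 0 (Fin.succ '' (S : Set (Fin 4)))) : Set (P 4 K)))).Nonempty →
      ((D₂.support : Set X') ∩ φ '' (ψ ⁻¹'
        (AffineCoordBlowup.CΛ 4 K (insert 0 (Fin.succ '' (S : Set (Fin 4)))) : Set (P 4 K)))).Nonempty →
      idx D₁ = idx D₂ → D₁ = D₂) :
    ∃ (Y' : Scheme.{0}) (φ' : Y' ⟶ W) (ψ' : Y' ⟶ P 4 K) (_ : IsOpenImmersion φ') (_ : IsOpenImmersion ψ'),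
      (controlledTransform π Ce I μ).comap φ' = J.comap ψ' ∧
      (vanishingIdeal (c.preimage π.continuous)).comap φ' =
        (AffineCoordBlowup.𝓘Λ 4 K (insert 0 (Fin.succ '' (S : Set (Fin 4))))).comap ψ' ∧
      ((c.preimage π.continuous : Closeds W) : Set W) ⊆ Set.range φ' ∧
      (AffineCoordBlowup.CΛ 4 K (insert 0 (Fin.succ '' (S : Set (Fin 4)))) : Set (P 4 K)) ⊆ Set.range ψ' ∧
      (∀ D : Set (P 4 K), D ⊆ Set.range ψ → IsClosed (φ '' (ψ ⁻¹' D)) →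
        (∀ B ∈ E, Disjoint (B.support : Set X') (φ '' (ψ ⁻¹' D))) → Disjoint (φ '' (ψ ⁻¹' D)) (Ce.support : Set X') →
        D ⊆ Set.range ψ' ∧ φ' '' (ψ' ⁻¹' D) = π ⁻¹' (φ '' (ψ ⁻¹' D)) ∧ IsClosed (φ' '' (ψ' ⁻¹' D)) ∧
          ∀ B ∈ E.map (strictTransformIdeal π Ce) ++ [Ce.comap π], Disjoint (B.support : Set W) (φ' '' (ψ' ⁻¹' D))) ∧
      ∃ (idx₂ : W.IdealSheafData → Fin 4) (cst₂ : W.IdealSheafData → K),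
        (∀ D₂ ∈ E.map (strictTransformIdeal π Ce) ++ [Ce.comap π],
          ((D₂.support : Set W) ∩ φ' '' (ψ' ⁻¹'
            (AffineCoordBlowup.CΛ 4 K (insert 0 (Fin.succ '' (S : Set (Fin 4)))) : Set (P 4 K)))).Nonempty →
          D₂.comap φ' = (ofIdealTop (Ideal.span {(γ 4 K).symm (X (idx₂ D₂).succ + C (cst₂ D₂))})).comap ψ' ∧
            (idx₂ D₂ ∈ S → cst₂ D₂ = 0)) ∧
        (∀ D₁ ∈ E.map (strictTransformIdeal π Ce) ++ [Ce.comap π], ∀ D₂ ∈ E.map (strictTransformIdeal π Ce) ++ [Ce.comap π],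
          ((D₁.support : Set W) ∩ φ' '' (ψ' ⁻¹'
            (AffineCoordBlowup.CΛ 4 K (insert 0 (Fin.succ '' (S : Set (Fin 4)))) : Set (P 4 K)))).Nonempty →
          ((D₂.support : Set W) ∩ φ' '' (ψ' ⁻¹'
            (AffineCoordBlowup.CΛ 4 K (insert 0 (Fin.succ '' (S : Set (Fin 4)))) : Set (P 4 K)))).Nonempty →
          idx₂ D₁ = idx₂ D₂ → D₁ = D₂) := by
  classical
  set O : X'.Opens := ⟨(Ce.support : Set X')ᶜ, Ce.support.isClosed.isOpen_compl⟩ with hO_def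
  have hO : Disjoint (O : Set X') Ce.support := disjoint_compl_left
  haveI : IsIso (π ∣_ O) := hπ.isIso_morphismRestrict hO
  have hcO : ∀ x : X', x ∈ (c : Set X') → x ∈ O := fun x hx h => hdisj.le_bot ⟨hx, h⟩
  have hmem := mem_member_iff_mem_CΛ φ ψ c hZ
  -- the transported chart (the construction of part 4, made explicit)
  set φ' : (φ ⁻¹ᵁ O : Scheme.{0}) ⟶ W := (φ ∣_ O) ≫ inv (π ∣_ O) ≫ (π ⁻¹ᵁ O).ι with hφ'
  set ψ' : (φ ⁻¹ᵁ O : Scheme.{0}) ⟶ P 4 K := (φ ⁻¹ᵁ O).ι ≫ ψ with hψ'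
  have hfac : φ' ≫ π = (φ ⁻¹ᵁ O).ι ≫ φ := comp_eq_of_zigzag_survival φ
  have hφ'π : ∀ y, π (φ' y) = φ ((φ ⁻¹ᵁ O).ι y) := fun y => by
    rw [← Scheme.Hom.comp_apply, hfac, Scheme.Hom.comp_apply]
  -- the survivor's centre set on the new chart is the old one
  have himg' : φ' '' (ψ' ⁻¹' (AffineCoordBlowup.CΛ 4 K (insert 0 (Fin.succ '' (S : Set (Fin 4)))) : Set (P 4 K))) ⊆
      π ⁻¹' (φ '' (ψ ⁻¹' (AffineCoordBlowup.CΛ 4 K (insert 0 (Fin.succ '' (S : Set (Fin 4)))) : Set (P 4 K)))) := by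
    rintro _ ⟨y, hy, rfl⟩
    rw [Set.mem_preimage, hφ'π]
    exact ⟨_, hy, rfl⟩
  -- members of the new boundary meeting the survivor come from members meeting `c`
  have hmeet : ∀ D₂ ∈ E.map (strictTransformIdeal π Ce) ++ [Ce.comap π],
      ((D₂.support : Set W) ∩ φ' '' (ψ' ⁻¹'
        (AffineCoordBlowup.CΛ 4 K (insert 0 (Fin.succ '' (S : Set (Fin 4)))) : Set (P 4 K)))).Nonempty →
      ∃ D ∈ E, strictTransformIdeal π Ce D = D₂ ∧
        ((D.support : Set X') ∩ φ '' (ψ ⁻¹'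
          (AffineCoordBlowup.CΛ 4 K (insert 0 (Fin.succ '' (S : Set (Fin 4)))) : Set (P 4 K)))).Nonempty := by
    intro D₂ hD₂ hne
    obtain ⟨w, hwD, hwc⟩ := hne
    have hπw := himg' hwc
    rw [Set.mem_preimage] at hπw
    rcases List.mem_append.mp hD₂ with hD₂ | hD₂
    · obtain ⟨D, hD, rfl⟩ := List.mem_map.mp hD₂
      refine ⟨D, hD, rfl, π w, ?_, hπw⟩
      have hle : D.comap π ≤ strictTransformIdeal π Ce D :=
        (comap_le_controlledTransform π Ce D 0).trans (controlledTransform_le_strictTransformIdeal π Ce D 0)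
      have hw' := Scheme.IdealSheafData.support_antitone hle hwD
      rw [Scheme.IdealSheafData.support_comap] at hw'
      exact hw'
    · -- the exceptional divisor does not meet the survivor
      exfalso
      rw [List.mem_singleton] at hD₂
      subst hD₂
      rw [Scheme.IdealSheafData.support_comap] at hwD
      have hπwc : π w ∈ (c : Set X') := by
        obtain ⟨y, hy, hyw⟩ := hπw
        rw [← hyw]
        exact (hmem y).mpr hy
      exact hdisj.le_bot ⟨hπwc, hwD⟩
  -- the new shape data: read through a chosen old member
  let pick : W.IdealSheafData → X'.IdealSheafData := fun D₂ =>
    if h : ∃ D ∈ E, strictTransformIdeal π Ce D = D₂ ∧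
        ((D.support : Set X') ∩ φ '' (ψ ⁻¹'
          (AffineCoordBlowup.CΛ 4 K (insert 0 (Fin.succ '' (S : Set (Fin 4)))) : Set (P 4 K)))).Nonempty
    then h.choose else ⊤
  have hpick : ∀ D₂ ∈ E.map (strictTransformIdeal π Ce) ++ [Ce.comap π],
      ((D₂.support : Set W) ∩ φ' '' (ψ' ⁻¹'
        (AffineCoordBlowup.CΛ 4 K (insert 0 (Fin.succ '' (S : Set (Fin 4)))) : Set (P 4 K)))).Nonempty →
      pick D₂ ∈ E ∧ strictTransformIdeal π Ce (pick D₂) = D₂ ∧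
        (((pick D₂).support : Set X') ∩ φ '' (ψ ⁻¹'
          (AffineCoordBlowup.CΛ 4 K (insert 0 (Fin.succ '' (S : Set (Fin 4)))) : Set (P 4 K)))).Nonempty := by
    intro D₂ hD₂ hne
    have h := hmeet D₂ hD₂ hne
    have hp : pick D₂ = h.choose := dif_pos h
    rw [hp]
    exact h.choose_spec
  -- visibility of a seen region survives
  have hvis : ∀ D : Set (P 4 K), D ⊆ Set.range ψ → IsClosed (φ '' (ψ ⁻¹' D)) →
      (∀ B ∈ E, Disjoint (B.support : Set X') (φ '' (ψ ⁻¹' D))) → Disjoint (φ '' (ψ ⁻¹' D)) (Ce.support : Set X') →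
      D ⊆ Set.range ψ' ∧ φ' '' (ψ' ⁻¹' D) = π ⁻¹' (φ '' (ψ ⁻¹' D)) ∧ IsClosed (φ' '' (ψ' ⁻¹' D)) ∧
        ∀ B ∈ E.map (strictTransformIdeal π Ce) ++ [Ce.comap π], Disjoint (B.support : Set W) (φ' '' (ψ' ⁻¹' D)) := by
    intro D hDsee hDc hbdD hDdisj
    have hDO : ∀ y : Y, ψ y ∈ D → φ y ∈ O := fun y hy h => hDdisj.le_bot ⟨⟨y, hy, rfl⟩, h⟩
    have himgD : φ' '' (ψ' ⁻¹' D) = π ⁻¹' (φ '' (ψ ⁻¹' D)) := by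
      ext w
      constructor
      · rintro ⟨y, hy, rfl⟩
        rw [Set.mem_preimage, hφ'π]
        exact ⟨_, hy, rfl⟩
      · rintro ⟨y, hy, hyw⟩
        have hyO : y ∈ φ ⁻¹ᵁ O := hDO y hy
        refine ⟨⟨y, hyO⟩, hy, ?_⟩
        refine eq_of_eq_of_not_mem_support hπ ?_ ?_
        · rw [hφ'π]; exact hyw
        · rw [hφ'π]; exact fun h => hO.le_bot ⟨hyO, h⟩
    refine ⟨fun x hx => ?_, himgD, by rw [himgD]; exact hDc.preimage π.continuous, fun B hB => ?_⟩
    · obtain ⟨y, rfl⟩ := hDsee hx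
      exact ⟨⟨y, hDO y hx⟩, rfl⟩
    · rw [himgD]
      rcases List.mem_append.mp hB with hB | hB
      · obtain ⟨B₀, hB₀, rfl⟩ := List.mem_map.mp hB
        refine Set.disjoint_left.mpr fun w hw hw' => ?_
        have hle : B₀.comap π ≤ strictTransformIdeal π Ce B₀ :=
          (comap_le_controlledTransform π Ce B₀ 0).trans (controlledTransform_le_strictTransformIdeal π Ce B₀ 0)
        have hw'' := Scheme.IdealSheafData.support_antitone hle hw
        rw [Scheme.IdealSheafData.support_comap] at hw''
        exact Set.disjoint_left.mp (hbdD B₀ hB₀) hw'' hw'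
      · rw [List.mem_singleton] at hB
        subst hB
        refine Set.disjoint_left.mpr fun w hw hw' => ?_
        rw [Scheme.IdealSheafData.support_comap] at hw
        exact hDdisj.le_bot ⟨hw', hw⟩
  refine ⟨(φ ⁻¹ᵁ O : Y.Opens), φ', ψ', inferInstance, inferInstance, ?_, ?_, ?_, ?_, hvis,
    fun D₂ => idx (pick D₂), fun D₂ => cst (pick D₂), fun D₂ hD₂ hne => ?_, fun D₁ hD₁ D₂ hD₂ hne₁ hne₂ hidx => ?_⟩
  · rw [hφ', Scheme.IdealSheafData.comap_comp, Scheme.IdealSheafData.comap_comp, comap_controlledTransform_ι_of_disjoint Ce I hO,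
      ← Scheme.IdealSheafData.comap_comp _ (inv (π ∣_ O)), IsIso.inv_hom_id, Scheme.IdealSheafData.comap_id,
      ← Scheme.IdealSheafData.comap_comp, morphismRestrict_ι, Scheme.IdealSheafData.comap_comp, hI,
      ← Scheme.IdealSheafData.comap_comp]
  · rw [← hπ.comap_vanishingIdeal_of_disjoint c hdisj, ← Scheme.IdealSheafData.comap_comp, hfac,
      Scheme.IdealSheafData.comap_comp, hZ, ← Scheme.IdealSheafData.comap_comp]
  · intro w hw
    have hwc : π w ∈ (c : Set X') := hw
    obtain ⟨y, hy⟩ := hcφ hwc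
    have hyO : y ∈ φ ⁻¹ᵁ O := by
      change φ y ∈ O
      rw [hy]
      exact hcO _ hwc
    have hwO : w ∈ π ⁻¹ᵁ O := hcO _ hwc
    refine ⟨⟨y, hyO⟩, ?_⟩
    have h1 : (φ ∣_ O) ⟨y, hyO⟩ = (π ∣_ O) ⟨w, hwO⟩ := by
      apply Subtype.ext
      rw [morphismRestrict_base_coe, morphismRestrict_base_coe]
      exact hy
    rw [hφ', Scheme.Hom.comp_apply, Scheme.Hom.comp_apply, h1, ← Scheme.Hom.comp_apply (π ∣_ O), IsIso.hom_inv_id]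
    rfl
  · intro v hv
    obtain ⟨y, hy⟩ := hsee hv
    have hyc : φ y ∈ (c : Set X') := (hmem y).mpr (by rw [hy]; exact hv)
    exact ⟨⟨y, hcO _ hyc⟩, by rw [hψ', Scheme.Hom.comp_apply]; exact hy⟩
  · -- the reading of a meeting member
    obtain ⟨hD, hst, hne'⟩ := hpick D₂ hD₂ hne
    obtain ⟨hread, hzero⟩ := hshape _ hD hne'
    refine ⟨?_, hzero⟩
    show D₂.comap φ' = (ofIdealTop (Ideal.span {(γ 4 K).symm (X (idx (pick D₂)).succ + C (cst (pick D₂)))})).comap ψ'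
    conv_lhs => rw [← hst, hφ', comap_strictTransformIdeal_zigzag_survival hO φ, hread]
    rw [hψ', ← Scheme.IdealSheafData.comap_comp]
  · -- injectivity of the index on meeting members
    obtain ⟨hD₁', hst₁, hne₁'⟩ := hpick D₁ hD₁ hne₁
    obtain ⟨hD₂', hst₂, hne₂'⟩ := hpick D₂ hD₂ hne₂
    have h := hinj _ hD₁' _ hD₂' hne₁' hne₂' hidx
    rw [← hst₁, ← hst₂, h]


end ShapeSees

end Equimultiple

end Summit.ResolutionOfSingularities.ResolutionOfSingularities.Theorems.PIDim4

end
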